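/-
Copyright (c) 2026. All rights reserved.
Released under Apache 2.0 license as described in the file LICENSE.
-/
import Literature.NumberTheory.ComplexMultiplication.DegenerateCMTypesAbelianKernels
import Literature.AlgebraicGeometry.Pohlmann1968.DegenerateCMTypesCyclicCMFieldTwoOddPrimes
import HarnessLib

/-!
# The rank of a CM type of an ABELIAN CM field by kernels: `Rank(Φ) + Σ_H φ([Gal:H]) = [K:ℚ]/2 + 1`, one vanishing
# odd character of `Gal(K/ℚ)` costs `φ` of its order, equidistribution at a kernel of prime-power index, and the
# parity `4 ∤ [K:ℚ] ⟹ Rank(Φ) ≡ [K:ℚ]/2 + 1 (mod 2)`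

T. Kubota, *On the field extension by complex multiplication*, Trans. AMS 118 (1965) [Kubota1965], §4 LEMMA 2:
"Let `(F; {σᵢ})` be a CM-type such that `F/ℚ` is an abelian extension. Denote by `G` the Galois group of `F/ℚ`, and
by `ρ ∈ G` the complex conjugation of `F`. Then, the defect of `(F; {σᵢ})` is equal to the number of characters `ψ`
of `G` satisfying `Σᵢ ψ(σᵢ) = 0`, `ψ(ρ) = −1`" (B. B. Gordon [Gordon1999HodgeAVSurvey] Prop. 9.4.1; tree
`isNondegenerate_iff_forall_oddCharacters`, `cmTypeRank_eq_one_add_ncard_oddCharacters`).  S. P. White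
[White1993SporadicCycles], proof of LEMMA 3 (p. 131): "Let `H` be the kernel of `χ`. Let `σ` generate the cyclic
group `G/H` … `χ` generates the character group of `G/H` and `χ` and `χᵗ` are conjugate ⟺ `(t, 2m) = 1`" — the
characters with a common kernel are conjugate over `ℚ` and vanish on a type together (group level:
`NumberTheory/ComplexMultiplication/DegenerateCMTypesAbelianKernels`, `sum_char_eq_zero_of_ker_eq`).

Number-field dress of that group-level file on the tree's CM types (`Motives.CMType K`, `cmTypeRank`,
`IsNondegenerate`) of a CM field `K`, GALOIS over `ℚ` with COMMUTATIVE Galois group `G = Gal(K/ℚ)` of ANY order,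
`ρ ∈ G` the complex conjugation at the base embedding `φ₀`, the type read on `G` as `S = {g : σ_g = φ₀ ∘ g⁻¹ ∈ Φ}`
(`Pohlmann1968.embOf`; `Rank(Φ) = rank(S)`, tree `cmTypeRank_eq_typeRank_galType`):

* **`cmTypeRank_add_sum_totient_eq`** — `Rank(Φ) + Σ_H φ([G:H]) = [K:ℚ]/2 + 1`, the sum over the subgroups `H ∌ ρ`
  of `G` with `G/H` cyclic whose characters (the characters of `G` with kernel exactly `H`; all or none) vanish on
  `S`; **`isNondegenerate_iff_forall_exists_ker`** (NONDEGENERATE iff for every such `H` one character with kernel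
  `H` does not vanish on `S` — one character per admissible kernel decides), `not_isNondegenerate_iff_exists_ker`.
* **`cmTypeRank_add_totient_le`** — an odd character `χ` of `Gal(K/ℚ)` with kernel `H` vanishing on `S` forces
  `Rank(Φ) + φ([G:H]) ≤ [K:ℚ]/2 + 1`; `cmTypeRank_add_totient_finrank_le_of_faithful` — a FAITHFUL one (then
  `Gal(K/ℚ)` is cyclic, `isCyclic_gal_of_faithful`) forces `Rank(Φ) + φ([K:ℚ]) ≤ [K:ℚ]/2 + 1` (`[K:ℚ] = 2pq`:
  `Rank ≤ p + q`, Hazama's cyclic examples, tree `DegenerateCMTypesCyclicCMFieldTwoOddPrimes`).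

* §3 **`cmTypeRank_add_totient_le_of_equidistributed`** — if `S` is EQUIDISTRIBUTED at a subgroup `H ∌ ρ` of `G`
  with cyclic quotient of order `2p^{a+1}` (`p` odd) — `#(S ∩ gxH) = #(S ∩ gH)` for all `g` and all `x` with
  `x^p ∈ H` — then `Rank(Φ) + φ(2p^{a+1}) ≤ [K:ℚ]/2 + 1` (group level: vanishing at a kernel of index `2p^{a+1}` IS
  equidistribution, `AbelianKernels.sum_char_eq_zero_iff_equidistributed_of_index`); `not_isNondegenerate_of_equidistributed`.
* §4 **`cmTypeRank_add_card_mod_two`** — `Rank(Φ) + #{H ≤ G : [G:H] = 2, ρ ∉ H, #(S ∩ H) = #(S ∖ H)} ≡ [K:ℚ]/2 + 1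
  (mod 2)` (the index-`2` subgroups `H ∌ ρ` are the imaginary quadratic subfields `K^H ⊆ K`, and `#(S ∩ H) = #(S ∖ H)`
  says that `Φ` restricts to `K^H` with equal multiplicities — this reading is not formalised here);
  **`cmTypeRank_mod_two_of_not_four_dvd`** — if `4 ∤ [K:ℚ]` then `Rank(Φ) ≡ [K:ℚ]/2 + 1 (mod 2)` for EVERY CM type
  `Φ` of `K`; `four_dvd_finrank_of_cmTypeRank_mod_two_ne`.

In the Galois correspondence the admissible `H` are the subfields `F = K^H ⊆ K` which are CM fields (`ρ ∉ H`) with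
CYCLIC `Gal(F/ℚ) = G/H`, `[F:ℚ] = [G:H]`; this reading is not formalised here.  For a PRIMITIVE `Φ`, a vanishing
odd character moreover puts a rational `(m,m)`-class outside `Dᵐ ⊗ ℂ` on every abelian variety of type `(K; Φ)`
(Lenstra; tree `AbelianCMField.exists_exceptional_of_oddCharacter`, not restated).  THEOREMS ONLY: no definition,
no named fact, no `sorry`.  HONEST SCOPE as in the group-level file: the `Σ_H φ` display is Kubota's count
regrouped by kernels, read off White's proof, not printed as a formula; the parity law of §4 is a corollary of the
grouping (`2 ∣ φ(n)` for `n > 2`), not printed in the sources; `p = 2` is excluded in §3.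

## References

* [Kubota1965] T. Kubota, Trans. AMS 118 (1965), §4 Lemma 2.
* [White1993SporadicCycles] S. P. White, Compositio Math. 88 (1993), §4, proof of Lemma 3 (p. 131).
* [Gordon1999HodgeAVSurvey] B. B. Gordon, *A survey of the Hodge conjecture for abelian varieties*, 9.4.1, 9.4.2.
* [Hazama2003CyclicCM] F. Hazama, J. Math. Sci. Univ. Tokyo 10 (2003), Prop. 4.3, Lemma 4.6.1, Thm. 4.8.
* [Dodson1987] B. Dodson, J. Algebra 111 (1987), §4.1, Prop. 4.4.
* [Shimura1998] G. Shimura, *Abelian Varieties with Complex Multiplication and Modular Functions*, §8.1, §18.2.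

## Provenance

Lane `lit-hodgefound` (Track 2, Layer A3/A4), seat `lit-hodgefound-p10` generation 36, row g36-#5 (field dress of
rows g36-#4 and g36-#6); neighbours cited
by name, nothing restated: `DegenerateCMTypesAbelianKernels` (group level), `DegenerateCMTypesCyclicCMFieldTwoOddPrimes`
(the Galois-level dictionary `isCMTypeWith_galType`, `cmTypeRank_eq_typeRank_galType`),
`SimpleDegenerateCMAbelianVarietiesCompositeDimension` (`card_gal_eq_finrank`), `NondegenerateCMTypeDivisorClasses`
(`isNondegenerate_iff`).
-/

open scoped BigOperators NumberField IsMulCommutative Classical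
open NumberField

namespace Literature.AlgebraicGeometry.Pohlmann1968

namespace AbelianKernels

open Literature.NumberTheory.ComplexMultiplication
open Literature.NumberTheory.ComplexMultiplication.CyclicCMType
open Literature.AlgebraicGeometry.Motives (CMType)
open Literature.AlgebraicGeometry.Pohlmann1968.CyclicTwoOddPrimes (isCMTypeWith_galType cmTypeRank_eq_typeRank_galType)

variable {K : Type} [Field K] [NumberField K] [Normal ℚ K] [IsMulCommutative (K ≃ₐ[ℚ] K)]
variable {ρ : K ≃ₐ[ℚ] K} {φ₀ : K →+* ℂ}

omit [IsMulCommutative (K ≃ₐ[ℚ] K)] in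
/-- `[K : ℚ]/2 = |Gal(K/ℚ)|/2`. [cite: Shimura1998, §8.1] -/
private theorem finrank_div_two_eq (φ₀ : K →+* ℂ) :
    Module.finrank ℚ K / 2 = Fintype.card (K ≃ₐ[ℚ] K) / 2 := by
  rw [card_gal_eq_finrank φ₀]

/-! ## §1 The rank by kernels -/

/-- **KUBOTA'S RANK BY KERNELS for an abelian CM field `K`** (`ρ ∈ Gal(K/ℚ)` the complex conjugation,
`σ_g = φ₀ ∘ g⁻¹`, `S = {g : σ_g ∈ Φ}`): `Rank(Φ) + Σ_H φ([G:H]) = [K:ℚ]/2 + 1`, the sum over the subgroups `H ∌ ρ`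
of `G = Gal(K/ℚ)` with `G/H` cyclic all of whose characters (the characters of `G` with kernel `H`) vanish on `S` —
Kubota's defect "the number of characters `ψ` of `G` satisfying `Σᵢ ψ(σᵢ) = 0`, `ψ(ρ) = −1`" grouped by kernel,
each admissible kernel carrying `φ([G:H])` conjugate characters. [cite: Kubota1965, §4 Lemma 2]
[cite: White1993SporadicCycles, §4, proof of Lemma 3 (p. 131)] [cite: Gordon1999HodgeAVSurvey, 9.4.1] -/
theorem cmTypeRank_add_sum_totient_eq (hρ : ∀ x, φ₀ (ρ x) = starRingEnd ℂ (φ₀ x)) (Φ : CMType K) :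
    cmTypeRank Φ +
      ∑ H ∈ (Finset.univ : Finset (Subgroup (K ≃ₐ[ℚ] K))).filter (fun H => ρ ∉ H ∧
        IsCyclic ((K ≃ₐ[ℚ] K) ⧸ H) ∧
        ∀ χ : AddChar (Additive (K ≃ₐ[ℚ] K)) ℂ, (∀ g : K ≃ₐ[ℚ] K, χ (Additive.ofMul g) = 1 ↔ g ∈ H) →
          ∑ s ∈ (Finset.univ.filter fun g : K ≃ₐ[ℚ] K => embOf φ₀ g ∈ Φ.1), χ (Additive.ofMul s) = 0),
        H.index.totient = Module.finrank ℚ K / 2 + 1 := by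
  rw [cmTypeRank_eq_typeRank_galType Φ φ₀, finrank_div_two_eq φ₀]
  exact AbelianKernels.typeRank_add_sum_totient_eq (isCMTypeWith_galType hρ Φ)

/-- **NONDEGENERATE iff one character per admissible kernel survives**: a CM type `Φ` of the abelian CM field `K` is
nondegenerate (`Rank(Φ) = [K:ℚ]/2 + 1`) iff for every subgroup `H ∌ ρ` of `Gal(K/ℚ)` with cyclic quotient SOME
character with kernel `H` has `Σ_{σ_g ∈ Φ} χ(g) ≠ 0` — Kubota's criterion (Gordon 9.4.1: nondegenerate iff no odd
character vanishes on the type) tested on one character per kernel. [cite: Kubota1965, §4 Lemma 2]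
[cite: White1993SporadicCycles, §4, proof of Lemma 3 (p. 131)] [cite: Gordon1999HodgeAVSurvey, 9.4.1] -/
theorem isNondegenerate_iff_forall_exists_ker (hρ : ∀ x, φ₀ (ρ x) = starRingEnd ℂ (φ₀ x)) (Φ : CMType K) :
    IsNondegenerate Φ ↔ ∀ H : Subgroup (K ≃ₐ[ℚ] K), ρ ∉ H → IsCyclic ((K ≃ₐ[ℚ] K) ⧸ H) →
      ∃ χ : AddChar (Additive (K ≃ₐ[ℚ] K)) ℂ, (∀ g : K ≃ₐ[ℚ] K, χ (Additive.ofMul g) = 1 ↔ g ∈ H) ∧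
        ∑ s ∈ (Finset.univ.filter fun g : K ≃ₐ[ℚ] K => embOf φ₀ g ∈ Φ.1), χ (Additive.ofMul s) ≠ 0 := by
  rw [_root_.Literature.AlgebraicGeometry.Pohlmann1968.isNondegenerate_iff, cmTypeRank_eq_typeRank_galType Φ φ₀,
    finrank_div_two_eq φ₀]
  exact AbelianKernels.typeRank_eq_iff_forall_exists_ker (isCMTypeWith_galType hρ Φ)

/-- **DEGENERATE iff the characters of some admissible kernel vanish**: `Φ` is degenerate iff some subgroup `H ∌ ρ`
of `Gal(K/ℚ)` with cyclic quotient is the kernel of a character vanishing on `{g : σ_g ∈ Φ}`.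
[cite: Kubota1965, §4 Lemma 2] [cite: White1993SporadicCycles, §4, proof of Lemma 3 (p. 131)] -/
theorem not_isNondegenerate_iff_exists_ker (hρ : ∀ x, φ₀ (ρ x) = starRingEnd ℂ (φ₀ x)) (Φ : CMType K) :
    ¬ IsNondegenerate Φ ↔ ∃ H : Subgroup (K ≃ₐ[ℚ] K), ρ ∉ H ∧ IsCyclic ((K ≃ₐ[ℚ] K) ⧸ H) ∧
      ∃ χ : AddChar (Additive (K ≃ₐ[ℚ] K)) ℂ, (∀ g : K ≃ₐ[ℚ] K, χ (Additive.ofMul g) = 1 ↔ g ∈ H) ∧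
        ∑ s ∈ (Finset.univ.filter fun g : K ≃ₐ[ℚ] K => embOf φ₀ g ∈ Φ.1), χ (Additive.ofMul s) = 0 := by
  rw [_root_.Literature.AlgebraicGeometry.Pohlmann1968.isNondegenerate_iff, cmTypeRank_eq_typeRank_galType Φ φ₀,
    finrank_div_two_eq φ₀]
  exact AbelianKernels.typeRank_ne_iff_exists_ker (isCMTypeWith_galType hρ Φ)

/-! ## §2 One vanishing odd character of `Gal(K/ℚ)` costs `φ([G : ker χ])` -/

/-- **ONE VANISHING ODD CHARACTER COSTS `φ([G : ker χ])`**: if an odd character `χ` of `Gal(K/ℚ)` (`χ(ρ) = −1`) with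
kernel `H` vanishes on `{g : σ_g ∈ Φ}`, then `Rank(Φ) + φ([G:H]) ≤ [K:ℚ]/2 + 1` (its `φ([G:H])` conjugates vanish
with it; Kubota). [cite: Kubota1965, §4 Lemma 2] [cite: White1993SporadicCycles, §4, proof of Lemma 3 (p. 131)] -/
theorem cmTypeRank_add_totient_le (hρ : ∀ x, φ₀ (ρ x) = starRingEnd ℂ (φ₀ x)) (Φ : CMType K)
    {H : Subgroup (K ≃ₐ[ℚ] K)} (χ : AddChar (Additive (K ≃ₐ[ℚ] K)) ℂ)
    (hker : ∀ g : K ≃ₐ[ℚ] K, χ (Additive.ofMul g) = 1 ↔ g ∈ H) (hχρ : χ (Additive.ofMul ρ) = -1)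
    (h0 : ∑ s ∈ (Finset.univ.filter fun g : K ≃ₐ[ℚ] K => embOf φ₀ g ∈ Φ.1), χ (Additive.ofMul s) = 0) :
    cmTypeRank Φ + H.index.totient ≤ Module.finrank ℚ K / 2 + 1 := by
  rw [cmTypeRank_eq_typeRank_galType Φ φ₀, finrank_div_two_eq φ₀]
  exact AbelianKernels.typeRank_add_totient_le (isCMTypeWith_galType hρ Φ) χ hker hχρ h0

/-- **A FAITHFUL odd character of `Gal(K/ℚ)` vanishing on the type forces `Rank(Φ) + φ([K:ℚ]) ≤ [K:ℚ]/2 + 1`** (for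
`[K:ℚ] = 2pq`: `Rank ≤ pq + 1 − (p−1)(q−1) = p + q`, the rank of Hazama's degenerate types of a cyclic CM field of
degree `2pq`). [cite: Kubota1965, §4 Lemma 2] [cite: Hazama2003CyclicCM, Prop. 4.3 and Thm. 4.8] -/
theorem cmTypeRank_add_totient_finrank_le_of_faithful (hρ : ∀ x, φ₀ (ρ x) = starRingEnd ℂ (φ₀ x)) (Φ : CMType K)
    (χ : AddChar (Additive (K ≃ₐ[ℚ] K)) ℂ) (hfaith : ∀ g : K ≃ₐ[ℚ] K, χ (Additive.ofMul g) = 1 → g = 1)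
    (hχρ : χ (Additive.ofMul ρ) = -1)
    (h0 : ∑ s ∈ (Finset.univ.filter fun g : K ≃ₐ[ℚ] K => embOf φ₀ g ∈ Φ.1), χ (Additive.ofMul s) = 0) :
    cmTypeRank Φ + (Module.finrank ℚ K).totient ≤ Module.finrank ℚ K / 2 + 1 := by
  rw [cmTypeRank_eq_typeRank_galType Φ φ₀, finrank_div_two_eq φ₀, ← card_gal_eq_finrank φ₀]
  exact AbelianKernels.typeRank_add_totient_card_le_of_faithful (isCMTypeWith_galType hρ Φ) χ hfaith hχρ h0

omit [Normal ℚ K] in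
/-- The Galois group of a number field carrying a faithful character is cyclic.
[cite: MontgomeryVaughan2007, §4.2 Thm. 4.4 (p. 116)] -/
theorem isCyclic_gal_of_faithful
    (χ : AddChar (Additive (K ≃ₐ[ℚ] K)) ℂ) (hfaith : ∀ g : K ≃ₐ[ℚ] K, χ (Additive.ofMul g) = 1 → g = 1) :
    IsCyclic (K ≃ₐ[ℚ] K) :=
  AbelianKernels.isCyclic_of_faithful χ hfaith

/-! ## §3 Equidistribution at a kernel of prime-power index forces degeneracy -/

section PrimePowerIndex

variable {p : ℕ} [hp : Fact p.Prime]

/-- **EQUIDISTRIBUTION AT A KERNEL OF INDEX `2p^{a+1}` COSTS `φ(2p^{a+1})`**: if `S = {g : σ_g ∈ Φ}` is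
equidistributed at a subgroup `H ∌ ρ` of `Gal(K/ℚ)` with cyclic quotient of order `2p^{a+1}` (`p` odd), then
`Rank(Φ) + φ(2p^{a+1}) ≤ [K:ℚ]/2 + 1` (the `φ(2p^{a+1})` odd characters with kernel `H` vanish on `S`).
[cite: Kubota1965, §4 Lemma 2] [cite: Hazama2003CyclicCM, Prop. 4.3 and Lemma 4.6.1] [cite: Dodson1987, Prop. 4.4] -/
theorem cmTypeRank_add_totient_le_of_equidistributed (hp2 : p ≠ 2) (hρ : ∀ x, φ₀ (ρ x) = starRingEnd ℂ (φ₀ x))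
    (Φ : CMType K) {H : Subgroup (K ≃ₐ[ℚ] K)} (hρH : ρ ∉ H) (hcyc : IsCyclic ((K ≃ₐ[ℚ] K) ⧸ H)) {a : ℕ}
    (hidx : H.index = 2 * p ^ (a + 1))
    (hEQ : ∀ x : K ≃ₐ[ℚ] K, x ^ p ∈ H → ∀ g : K ≃ₐ[ℚ] K,
      ((Finset.univ.filter fun g : K ≃ₐ[ℚ] K => embOf φ₀ g ∈ Φ.1).filter fun s => (g * x)⁻¹ * s ∈ H).card =
        ((Finset.univ.filter fun g : K ≃ₐ[ℚ] K => embOf φ₀ g ∈ Φ.1).filter fun s => g⁻¹ * s ∈ H).card) :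
    cmTypeRank Φ + (2 * p ^ (a + 1)).totient ≤ Module.finrank ℚ K / 2 + 1 := by
  have h := isCMTypeWith_galType hρ Φ
  have hρ2 : ρ * ρ = 1 := by
    have := h.invol (1 : K ≃ₐ[ℚ] K)
    simpa [smul_eq_mul] using this
  obtain ⟨χ, hχρ, hker⟩ := AbelianKernels.exists_oddChar_ker hρH hρ2 hcyc
  have h0 := (AbelianKernels.sum_char_eq_zero_iff_equidistributed_of_index hp2 h χ hχρ hker hidx).2 hEQ
  rw [cmTypeRank_eq_typeRank_galType Φ φ₀, finrank_div_two_eq φ₀, ← hidx]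
  exact AbelianKernels.typeRank_add_totient_le h χ hker hχρ h0

/-- **Equidistribution at an admissible kernel of prime-power index makes the type DEGENERATE.**
[cite: Kubota1965, §4 Lemma 2] [cite: Hazama2003CyclicCM, Prop. 4.3] [cite: Dodson1987, Prop. 4.4] -/
theorem not_isNondegenerate_of_equidistributed (hp2 : p ≠ 2) (hρ : ∀ x, φ₀ (ρ x) = starRingEnd ℂ (φ₀ x))
    (Φ : CMType K) {H : Subgroup (K ≃ₐ[ℚ] K)} (hρH : ρ ∉ H) (hcyc : IsCyclic ((K ≃ₐ[ℚ] K) ⧸ H)) {a : ℕ}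
    (hidx : H.index = 2 * p ^ (a + 1))
    (hEQ : ∀ x : K ≃ₐ[ℚ] K, x ^ p ∈ H → ∀ g : K ≃ₐ[ℚ] K,
      ((Finset.univ.filter fun g : K ≃ₐ[ℚ] K => embOf φ₀ g ∈ Φ.1).filter fun s => (g * x)⁻¹ * s ∈ H).card =
        ((Finset.univ.filter fun g : K ≃ₐ[ℚ] K => embOf φ₀ g ∈ Φ.1).filter fun s => g⁻¹ * s ∈ H).card) :
    ¬ IsNondegenerate Φ := by
  have hle := cmTypeRank_add_totient_le_of_equidistributed hp2 hρ Φ hρH hcyc hidx hEQ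
  have hpos : 0 < (2 * p ^ (a + 1)).totient :=
    Nat.totient_pos.2 (mul_pos two_pos (pow_pos hp.out.pos _))
  rw [_root_.Literature.AlgebraicGeometry.Pohlmann1968.isNondegenerate_iff]
  omega

end PrimePowerIndex

/-! ## §4 The parity of the rank -/

/-- **THE RANK MOD 2**: `Rank(Φ) + #{H ≤ Gal(K/ℚ) : [G:H] = 2, ρ ∉ H, #(S ∩ H) = #(S ∖ H)} ≡ [K:ℚ]/2 + 1 (mod 2)`
(the `H` counted are the imaginary quadratic subfields of `K` over which `Φ` is evenly split; every other admissible
kernel contributes an even number `φ([G:H])` of vanishing odd characters). [cite: Kubota1965, §4 Lemma 2] -/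
theorem cmTypeRank_add_card_mod_two (hρ : ∀ x, φ₀ (ρ x) = starRingEnd ℂ (φ₀ x)) (Φ : CMType K) :
    (cmTypeRank Φ + ((Finset.univ : Finset (Subgroup (K ≃ₐ[ℚ] K))).filter fun H => ρ ∉ H ∧ H.index = 2 ∧
        ((Finset.univ.filter fun g : K ≃ₐ[ℚ] K => embOf φ₀ g ∈ Φ.1).filter fun s => s ∈ H).card =
          ((Finset.univ.filter fun g : K ≃ₐ[ℚ] K => embOf φ₀ g ∈ Φ.1).filter fun s => s ∉ H).card).card) % 2 =
      (Module.finrank ℚ K / 2 + 1) % 2 := by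
  rw [cmTypeRank_eq_typeRank_galType Φ φ₀, finrank_div_two_eq φ₀]
  exact AbelianKernels.typeRank_add_card_mod_two (isCMTypeWith_galType hρ Φ)

/-- **`4 ∤ [K:ℚ] ⟹ Rank(Φ) ≡ [K:ℚ]/2 + 1 (mod 2)` for every CM type `Φ` of the abelian CM field `K`** (the defect is
even: `[K:ℚ]/2 = |S|` is odd, so no index-`2` subgroup of `Gal(K/ℚ)` splits `S` evenly, and all other admissible
kernels contribute even numbers of vanishing odd characters) — e.g. degree `2p^k`: defect `Σ (p^{i+1} − p^i)`;
degree `2pq`: Hazama's rank `p + q`, defect `(p−1)(q−1)`. [cite: Kubota1965, §4 Lemma 2]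
[cite: Hazama2003CyclicCM, Prop. 4.3 and Thm. 4.8] -/
theorem cmTypeRank_mod_two_of_not_four_dvd (hρ : ∀ x, φ₀ (ρ x) = starRingEnd ℂ (φ₀ x)) (Φ : CMType K)
    (h4 : ¬ 4 ∣ Module.finrank ℚ K) : cmTypeRank Φ % 2 = (Module.finrank ℚ K / 2 + 1) % 2 := by
  rw [cmTypeRank_eq_typeRank_galType Φ φ₀, finrank_div_two_eq φ₀]
  rw [← card_gal_eq_finrank φ₀] at h4
  exact AbelianKernels.typeRank_mod_two_of_not_four_dvd (isCMTypeWith_galType hρ Φ) h4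

/-- **Nondegenerate types of an abelian CM field of degree `≢ 0 (mod 4)` have EVEN defect; equivalently a type of
ODD defect (`Rank(Φ) ≢ [K:ℚ]/2 + 1 (mod 2)`) can only exist when `4 ∣ [K:ℚ]`.** [cite: Kubota1965, §4 Lemma 2] -/
theorem four_dvd_finrank_of_cmTypeRank_mod_two_ne (hρ : ∀ x, φ₀ (ρ x) = starRingEnd ℂ (φ₀ x)) (Φ : CMType K)
    (hne : cmTypeRank Φ % 2 ≠ (Module.finrank ℚ K / 2 + 1) % 2) : 4 ∣ Module.finrank ℚ K := by
  by_contra h4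
  exact hne (cmTypeRank_mod_two_of_not_four_dvd hρ Φ h4)

end AbelianKernels

end Literature.AlgebraicGeometry.Pohlmann1968
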